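import Literature.MathematicalPhysics.QuantumFieldTheory.BalabanImbrieJaffe1984to88.BIJ88NeumannCubePartitionTorus
import Literature.MathematicalPhysics.QuantumFieldTheory.BalabanImbrieJaffe1984to88.BIJ88NeumannCommutator210Torus
import Literature.MathematicalPhysics.QuantumFieldTheory.BalabanImbrieJaffe1984to88.BIJ88NeumannPropagatorTranslCovTorus
import Literature.MathematicalPhysics.QuantumFieldTheory.BalabanImbrieJaffe1984to88.BIJ88NeumannPropagatorSmallFieldSupDecay
import Literature.MathematicalPhysics.QuantumFieldTheory.BalabanImbrieJaffe1984to88.BIJ88NeumannPropagatorSmallFieldCubeDeriv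

/-!
# `BalabanImbrieJaffe1984to88.BIJ88NeumannRandomWalkSmallFieldTorus` — [6] (2.12)/(2.13) for `G_k(u)` on the torus: the letters `K_iG_k(□_i,u)` are `O(M₀⁻¹)` at small fields, and the random walk expansion converges

T. Bałaban, *Regularity and decay of lattice Green's functions*, Comm. Math. Phys. **89** (1983) 571–597 [Balaban1983RegularityDecay]
(= [6] of Bałaban–Imbrie–Jaffe, *CMP* **114** (1988)), §2 pp. 575–578: the partition of unity `{h_j}` and the cubes `□_j` (p. 575), the
commutator letters `K_j` (2.10), the remainder `R` (2.11), *"R is a small operator in reasonable norms because |∂^ηh_j| ≦ O(M⁻¹),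
|Δ^ηh_j| ≦ O(M⁻²), so we have the representations G_k(Ω,A) = G₀(I − R)⁻¹ = Σ G₀Rⁿ (2.12)"* (p. 577 l. 1–3), the random walk
representation (2.13), and *"M fixed with 3^dc₂O(1)M⁻¹ ≦ e⁻¹"* ((2.22) p. 579).

## What this file proves

The last analytic input of gen 25/26's torus version of (2.12)/(2.13) (`BIJ88NeumannRandomWalkTorus.hasSum_piece_of_inputs` →
`BIJ88NeumannCubePartitionTorus.hasSum_piece_cubes`: everything combinatorial discharged, the letter bound `‖K_iG_k(Ω∩□_i,u)‖ ≤ β`,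
`3^dβ < 1` left as the hypothesis) is DISCHARGED for `Ω = T^{(0)}` (the whole torus, `G_k(u)` itself) at small fields:

* §1 `abs_hT_second_diff_le` — **«|Δ^ηh_j| ≦ O(M⁻²)»**: `|h_i(x+e_μ) − 2h_i(x) + h_i(x−e_μ)| ≤ 3·sup|h″|/M²` at every site of the torus
  (seam-safe, r01's `abs_second_diff_le_D2`; the first-difference companion is file 1's `abs_hT_sub_le`);
* §2 `image_box_eq_cube` — the window `□_i` is the translate of the NO-WRAP corner box `□′ = [0,2M)^d` (the tree's `cubeT` at corner `0`)
  by `v_i = Mi − M ∈ L^kℤ^d` (`isCoarse_shiftVec`), so the block-lattice covariance of `BIJ88NeumannPropagatorTranslCovTorus` moves the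
  letter there: `kLet_translate`, `norm_letter_translate` (§5);
* §3 deep rows: a row `x` of the moved letter is either OFF the annulus (`kLet_translate_mulVec_eq_zero`, file 1's support statement) or
  `(L^k+1)`-deep in `□′` (`deep_of_near`, `M₀ ≥ 16`), where all `2d` bonds lie in `□′` (`bonds_mem_starB_of_deep`) and every `L^k`-ball in
  the sup torus distance stays in `□′` (`ball_subset_box_of_deep`) — the deep-row hypothesis of the tree's derivative member;
* §4 `norm_kLet_mulVec_le` — **the row estimate of (2.10)** (file 2's three-term form `kLet_mulVec`): `|(K_iφ)(x)| ≤ |c|·2d·δ₁Ψ +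
  c²·d·δ₂Φ + |a|L^{−kd}δ₃Φ` from first/second differences `δ₁, δ₂` of `h_i`, its block oscillation `δ₃`, `|φ| ≤ Φ`, `|D_uφ| ≤ Ψ`;
* §6 **`norm_letter_le`: `‖K_iG_k(□_i,u)‖_{∞→∞} ≤ C(d,L,a)/M₀`** for every window, every `1 ≤ k ≤ K`, `M₀ ≥ 16`, `|T|/M ≥ 3`, every `U(1)`
  field small in the sense of the tree's (1.10) members — with `Φ = c₀(L^kε)²`, `Ψ = c₁(L^kε)` from p27's `decay110_smallField_cube_input`
  (every row) and p34/p27's `decay110_smallField_cube_deriv_input` (deep rows) on `□′` for the translated field `τ_{v_i}u`, and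
  `δ₁ = 3D₁/M`, `δ₂ = 3D₂/M²`, `δ₃ = 3dD₁L^k/M`: the three terms are `6dD₁c₁/M₀`, `3dD₂c₀/M₀²`, `3dD₁c₀a_k/M₀` (`c = ε⁻¹`, `a = a_k(L^kε)⁻²L^{kd}`,
  `a_k ≤ a`) — **`k`-UNIFORM**; and its companion `norm_gBox_cube_le`: `‖G_k(□_i,u)‖_{∞→∞} ≤ c₀(L^kε)²` (the boundedness of the first
  letters, Lemma 2.1's role in (2.12), from the value member alone);
* §7 **`hasSum_piece_torus`**: for `M₀ ≥ M₁(d,L,a) := max(16, ⌈3^{P.d}C⌉ + 1)` the random walk expansion (2.13) of `G_k(u)` over [6]'s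
  cubes converges to `gBox … univ` (file 1's `hasSum_piece_cubes` with `β = C/M₀`, `3^dβ < 1`, `2^dβ < 1`).

Scope (stated, not hidden): level `j = 0` tori of the series with `P.d = d + 1 ≤ 3`, `d ≥ 1`, `L` odd `> 1` (the scope of the tree's
small-field cube members); `Ω = T^{(0)}` only — for a general `M`-aligned block union `Ω` the rows of `K_i` on the inner faces of `Ω` need
tangential covariant-derivative bounds at Neumann boundary rows, which the tree does not have (the print gets them from (2.42)–(2.47)
with `A_j` constant near `∂□_j`); the `ℓ^∞ → ℓ^∞` operator norm (Mathlib scope `Matrix.Norms.Operator`, the norm of gen 25's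
`hasSum`); constants not optimised.

Carrier and vocabulary BY NAME: files 1–3 of this seat (`BIJ88NeumannCubePartitionTorus`: `half`, `nLab`, `Lab`, `CubeSize`, `ctr`,
`Near`, `cube`, `hT`, `abs_hT_sub_le`, `kLet_apply_eq_zero_of_not_near_left`, `hasSum_piece_cubes`; `BIJ88NeumannCommutator210Torus`:
`kLet_mulVec`, `norm_gradTerm_le`, `lapNh_eq_of_forall_mem`, `norm_blockTerm_le`; `BIJ88NeumannPropagatorTranslCovTorus`: `IsCoarse`,
`nOp_translate`, `gBox_translate`, `holCK_translate`, `blkIter_src_eq_tgt_iff`, `norm_submatrix_add`; plaquettes by `GaugeField.plaqHol_translate`), gen 25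
`BIJ88NeumannRandomWalkTorus` (`kLet`, `piece`, `mulR`), p27/p34 `BIJ88NeumannPropagatorSmallFieldSupDecay`/`…CubeDeriv` (the members),
p31 gen 16 `BIJ88NeumannPropagatorFlatDecayCube` (`cubeT`, `mem_cubeT_iff_val`), r01 `B4PartitionUnity22` (`hprof`, `D1`, `D2`,
`abs_second_diff_le_D2`), p35 `B1TorusCubeCover` (`per3`), `B1.aSeq_pos`/`aSeq_le`, `B1RG242Torus.α`, `B5Ineq137Torus.T`,
`B4TorusKernel.MultiPeriod.circAbs`.  No `def … : Prop`; definitions with bodies: `shiftVec`, `box`, `Deep`, `boxFam`, `hFam`.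

statement-level skeleton of published theorems with citation tags; proofs where landed; nothing here is a claim about the Yang–Mills mass gap

## References
* [Balaban1983RegularityDecay] T. Bałaban, Comm. Math. Phys. 89 (1983) 571–597, §2 (2.10)–(2.13) pp. 576–577, (2.19)–(2.21) p. 578, (2.22) p. 579.
* [BalabanImbrieJaffe1985] T. Bałaban, J. Imbrie, A. Jaffe, Comm. Math. Phys. 97 (1985) 299–329, (5.1.2)–(5.1.3) p. 313.
* [BalabanImbrieJaffe1988] T. Bałaban, J. Imbrie, A. Jaffe, Comm. Math. Phys. 114 (1988) 257–315, (2.27) p. 263, before (2.65) p. 270.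
-/

open scoped BigOperators Matrix ComplexConjugate
open Finset Matrix

namespace Literature.MathematicalPhysics.QuantumFieldTheory.BalabanImbrieJaffe1984to88.BIJ88NeumannRandomWalkSmallFieldTorus

open Literature.MathematicalPhysics.QuantumFieldTheory.Balaban1983to89
open BIJ88Sect3Statements (U1 toC cfg covD starB mem_starB norm_toC)
open BIJ85BlockAveragesTorus BIJ85BlockAveragesTorusK
open BIJ85BlockKPoincare (val_blkIter)
open BIJ88NeumannNoZeroModesTorus BIJ88NeumannPropagator227Torus
open BIJ88NeumannRandomWalkTorus BIJ88NeumannCubePartitionTorus BIJ88NeumannCommutator210Torus BIJ88NeumannPropagatorTranslCovTorus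
open BIJ88NeumannPropagatorFlatDecayCube (cubeT mem_cubeT_iff_val)
open B4PartitionUnity22 (hprof contDiff_hprof hasCompactSupport_hprof D1 D2 D1_nonneg D2_nonneg abs_second_diff_le_D2)
open B1TorusCubeCover (per3 per3_hprof_mem_Icc hprof_zero_of_one_le)

noncomputable section

variable {P : Params}

/-! ## §0 Kernel bookkeeping: row sums, the duality `Σ_y|A(x,y)| = sup_{|f|≤1}|(Af)(x)|`, labels -/

section Kernel

open scoped Matrix.Norms.Operator

/-- kernel: a matrix whose row sums are `≤ C` has `ℓ^∞ → ℓ^∞` norm `≤ C`. [folklore] -/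
private theorem linfty_opNorm_le_of_rows {m n : Type*} [Fintype m] [Fintype n] {A : Matrix m n ℂ} {C : ℝ} (hC : 0 ≤ C)
    (h : ∀ i, ∑ j, ‖A i j‖ ≤ C) : ‖A‖ ≤ C := by
  rw [linfty_opNorm_def]
  have : ((Finset.univ.sup fun i => ∑ j, ‖A i j‖₊ : NNReal) : ℝ) ≤ C := by
    rw [← Real.coe_toNNReal C hC, NNReal.coe_le_coe]
    refine Finset.sup_le fun i _ => ?_
    rw [← NNReal.coe_le_coe, Real.coe_toNNReal C hC, NNReal.coe_sum]
    simpa using h i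
  exact this

/-- kernel: **the row sum is attained** — `Σ_y |A(x,y)| = (Af)(x)` for the unimodular `f(y) = conj(A(x,y))/|A(x,y)|`. [folklore] -/
private theorem exists_mulVec_eq_rowSum {m n : Type*} [Fintype n] (A : Matrix m n ℂ) (x : m) :
    ∃ f : n → ℂ, (∀ y, ‖f y‖ ≤ 1) ∧ (A *ᵥ f) x = ((∑ y, ‖A x y‖ : ℝ) : ℂ) := by
  refine ⟨fun y => if A x y = 0 then 0 else (starRingEnd ℂ) (A x y) / (‖A x y‖ : ℂ), fun y => ?_, ?_⟩
  · dsimp only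
    by_cases h : A x y = 0
    · simp [h]
    · rw [if_neg h, norm_div, Complex.norm_conj, Complex.norm_real, Real.norm_eq_abs, abs_of_nonneg (norm_nonneg _),
        div_self (norm_ne_zero_iff.2 h)]
  · simp only [mulVec, dotProduct]
    push_cast
    refine Finset.sum_congr rfl fun y _ => ?_
    by_cases h : A x y = 0
    · simp [h]
    · rw [if_neg h, mul_div_assoc', Complex.mul_conj, Complex.normSq_eq_norm_sq]
      push_cast
      rw [sq, mul_div_assoc, div_self (by exact_mod_cast norm_ne_zero_iff.2 h), mul_one]

/-- kernel: `‖A‖_{∞→∞} ≤ C` once `|(Af)(x)| ≤ C` for every row `x` and every `f` with `|f| ≤ 1` (the operator norm of the «reasonable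
norms» of (2.12), row by row). [cite: Balaban1983RegularityDecay, (2.12) p.577] -/
theorem linfty_opNorm_le_of_mulVec_le {m n : Type*} [Fintype m] [Fintype n] {A : Matrix m n ℂ} {C : ℝ} (hC : 0 ≤ C)
    (h : ∀ (f : n → ℂ), (∀ y, ‖f y‖ ≤ 1) → ∀ x, ‖(A *ᵥ f) x‖ ≤ C) : ‖A‖ ≤ C := by
  refine linfty_opNorm_le_of_rows hC fun x => ?_
  obtain ⟨f, hf, hfx⟩ := exists_mulVec_eq_rowSum A x
  have h1 := h f hf x
  rw [hfx, Complex.norm_real, Real.norm_eq_abs, abs_of_nonneg (Finset.sum_nonneg fun _ _ => norm_nonneg _)] at h1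
  exact h1

end Kernel

/-- kernel: the `ℓ¹` torus distance of the two ends of a bond is `≤ 1`. [folklore] -/
private theorem tdist_shift_le {j : ℕ} (x : Balaban1983to89.Site P j) (μ : Fin P.d) : Balaban1983to89.Site.tdist x (x.shift μ) ≤ 1 := by
  unfold Balaban1983to89.Site.tdist
  rw [Finset.sum_eq_single μ]
  · have e : (x.shift μ) μ = x μ + 1 := by show Function.update x μ (x μ + 1) μ = _; rw [Function.update_self]
    rw [e, show x μ + 1 - x μ = 1 by ring]
    refine (min_le_right _ _).trans ?_
    rw [ZMod.val_one_eq_one_mod]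
    exact Nat.mod_le 1 _
  · intro ν _ hν
    have e : (x.shift μ) ν = x ν := by show Function.update x μ (x μ + 1) ν = _; rw [Function.update_of_ne hν]
    rw [e, sub_self, ZMod.val_zero, Nat.zero_min]
  · intro h; exact absurd (Finset.mem_univ μ) h

/-- kernel: `tdist` is symmetric. [folklore] -/
private theorem tdist_comm {j : ℕ} (x y : Balaban1983to89.Site P j) : Balaban1983to89.Site.tdist x y = Balaban1983to89.Site.tdist y x := by
  unfold Balaban1983to89.Site.tdist
  exact Finset.sum_congr rfl fun μ _ => min_comm _ _

/-- kernel: two sites of one `k`-block are at `ℓ¹` distance `≤ d(L^k − 1)`. [cite: BalabanImbrieJaffe1985, (5.1.2)–(5.1.3) p.313] -/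
private theorem tdist_le_of_blkIter_eq {j k : ℕ} (hk : j + k ≤ P.m + P.K) {x y : Balaban1983to89.Site P j} (h : blkIter k x = blkIter k y) :
    Balaban1983to89.Site.tdist x y ≤ P.d * (P.L ^ k - 1) := by
  unfold Balaban1983to89.Site.tdist
  have hn : 0 < P.L ^ k := pow_pos P.L_pos k
  have key : ∀ μ, min (x μ - y μ).val (y μ - x μ).val ≤ P.L ^ k - 1 := by
    intro μ
    have hq : (x μ).val / P.L ^ k = (y μ).val / P.L ^ k := by
      rw [← val_blkIter k hk x μ, ← val_blkIter k hk y μ, h]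
    have h1 := Nat.div_mul_le_self (x μ).val (P.L ^ k)
    have h2 : (x μ).val < (x μ).val / P.L ^ k * P.L ^ k + P.L ^ k := Nat.lt_div_mul_add hn
    have h3 := Nat.div_mul_le_self (y μ).val (P.L ^ k)
    have h4 : (y μ).val < (y μ).val / P.L ^ k * P.L ^ k + P.L ^ k := Nat.lt_div_mul_add hn
    rw [hq] at h1 h2
    set q := (y μ).val / P.L ^ k * P.L ^ k
    by_cases hle : (y μ).val ≤ (x μ).val
    · exact (min_le_left _ _).trans (by rw [ZMod.val_sub hle]; omega)
    · exact (min_le_right _ _).trans (by rw [ZMod.val_sub (by omega)]; omega)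
  calc ∑ μ, min (x μ - y μ).val (y μ - x μ).val ≤ ∑ _μ : Fin P.d, (P.L ^ k - 1) := Finset.sum_le_sum fun μ _ => key μ
    _ = P.d * (P.L ^ k - 1) := by rw [Finset.sum_const, Finset.card_univ, Fintype.card_fin, smul_eq_mul]

/-! ## §1 The second differences of the cut-offs: `|Δ²_μh_i| ≤ 3·sup|h″|/M²` on the torus (seam-safe) -/

section SecondDiff

variable {j k M₀ : ℕ}

/-- kernel: `|Δ²h_per| ≤ 3·sup|h″|·η²` for the periodisation `h_per = per3 h N` (three translates). [cite: Balaban1983RegularityDecay, §2 p.575] -/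
theorem abs_per3_hprof_second_diff_le (Nn : ℕ) (t η : ℝ) :
    |per3 hprof Nn (t + η) - 2 * per3 hprof Nn t + per3 hprof Nn (t - η)| ≤ 3 * D2 hprof * η ^ 2 := by
  unfold per3
  have h1 := abs_second_diff_le_D2 contDiff_hprof hasCompactSupport_hprof t η
  have h2 := abs_second_diff_le_D2 contDiff_hprof hasCompactSupport_hprof (t - Nn) η
  have h3 := abs_second_diff_le_D2 contDiff_hprof hasCompactSupport_hprof (t + Nn) η
  rw [show t - Nn + η = t + η - Nn by ring, show t - Nn - η = t - η - Nn by ring] at h2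
  rw [show t + Nn + η = t + η + Nn by ring, show t + Nn - η = t - η + Nn by ring] at h3
  calc |hprof (t + η) + hprof (t + η - Nn) + hprof (t + η + Nn) - 2 * (hprof t + hprof (t - Nn) + hprof (t + Nn))
          + (hprof (t - η) + hprof (t - η - Nn) + hprof (t - η + Nn))|
        = |(hprof (t + η) - 2 * hprof t + hprof (t - η)) + (hprof (t + η - Nn) - 2 * hprof (t - Nn) + hprof (t - η - Nn))
            + (hprof (t + η + Nn) - 2 * hprof (t + Nn) + hprof (t - η + Nn))| := by ring_nf
    _ ≤ |hprof (t + η) - 2 * hprof t + hprof (t - η)| + |hprof (t + η - Nn) - 2 * hprof (t - Nn) + hprof (t - η - Nn)|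
            + |hprof (t + η + Nn) - 2 * hprof (t + Nn) + hprof (t - η + Nn)| := abs_add_three _ _ _
    _ ≤ D2 hprof * η ^ 2 + D2 hprof * η ^ 2 + D2 hprof * η ^ 2 := add_le_add (add_le_add h1 h2) h3
    _ = 3 * D2 hprof * η ^ 2 := by ring

/-- **ONE DIRECTION, SEAM-SAFE**: `|h_per((v+1)/M − i) − 2h_per(v/M − i) + h_per((v−1)/M − i)| ≤ 3·sup|h″|/M²` for torus labels
`v ∈ ℤ/|T|ℤ` read in `[0, |T|)` (across the seam one argument is shifted by the period `N`, where `h_per` is `N`-periodic).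
[cite: Balaban1983RegularityDecay, (2.10) p.576] -/
theorem abs_per3_dir_second_diff_le (hC : CubeSize P j k M₀) (i : Fin (nLab P j k M₀)) (v : ZMod (P.sitesPerDir j)) :
    |per3 hprof (nLab P j k M₀) ((((v + 1).val : ℕ) : ℝ) / half P k M₀ - ((i : ℕ) : ℝ))
        - 2 * per3 hprof (nLab P j k M₀) (((v.val : ℕ) : ℝ) / half P k M₀ - ((i : ℕ) : ℝ))
        + per3 hprof (nLab P j k M₀) ((((v - 1).val : ℕ) : ℝ) / half P k M₀ - ((i : ℕ) : ℝ))|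
      ≤ 3 * D2 hprof / (half P k M₀ : ℝ) ^ 2 := by
  have hh : 0 < half P k M₀ := hC.pos_half
  have hhR : (0 : ℝ) < half P k M₀ := by exact_mod_cast hh
  have hS := nLab_mul_half hC
  have hN := hC.two_le
  have hSR : ((nLab P j k M₀ : ℕ) : ℝ) * (half P k M₀ : ℝ) = (P.sitesPerDir j : ℝ) := by exact_mod_cast hS
  have hiN : ((i : ℕ) : ℝ) + 1 ≤ (nLab P j k M₀ : ℝ) := by exact_mod_cast i.isLt
  have hi0 : (0 : ℝ) ≤ ((i : ℕ) : ℝ) := by positivity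
  haveI : NeZero (P.sitesPerDir j) := ⟨by have := P.one_lt_sitesPerDir j; omega⟩
  have hS2 : 2 ≤ P.sitesPerDir j := by
    have := hC.two_mul_half_le; omega
  set t : ℝ := ((v.val : ℕ) : ℝ) / half P k M₀ - ((i : ℕ) : ℝ) with ht
  have key := abs_per3_hprof_second_diff_le (nLab P j k M₀) t (1 / (half P k M₀ : ℝ))
  rw [show 3 * D2 hprof * (1 / (half P k M₀ : ℝ)) ^ 2 = 3 * D2 hprof / (half P k M₀ : ℝ) ^ 2 by field_simp] at key
  have hv : v.val < P.sitesPerDir j := ZMod.val_lt v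
  -- the three label configurations: interior, top seam (`v = |T| − 1`), bottom seam (`v = 0`)
  have hplus : (((v + 1).val : ℕ) : ℝ) / half P k M₀ - ((i : ℕ) : ℝ) = t + 1 / (half P k M₀ : ℝ)
      ∨ (v.val + 1 = P.sitesPerDir j ∧ (v + 1).val = 0) := by
    by_cases htop : v.val + 1 = P.sitesPerDir j
    · right
      refine ⟨htop, ?_⟩
      rw [ZMod.val_add, ZMod.val_one, htop, Nat.mod_self]
    · left
      rw [ZMod.val_add_of_lt (by rw [ZMod.val_one]; omega), ZMod.val_one, ht]
      push_cast
      field_simp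
      ring
  have hminus : (((v - 1).val : ℕ) : ℝ) / half P k M₀ - ((i : ℕ) : ℝ) = t - 1 / (half P k M₀ : ℝ)
      ∨ (v.val = 0 ∧ (v - 1).val + 1 = P.sitesPerDir j) := by
    by_cases hbot : v.val = 0
    · right
      refine ⟨hbot, ?_⟩
      have hv0 : v = 0 := (ZMod.val_eq_zero v).1 hbot
      rw [hv0, zero_sub, ZMod.neg_val, if_neg one_ne_zero, ZMod.val_one]
      omega
    · left
      have h1v : (1 : ZMod (P.sitesPerDir j)).val ≤ v.val := by rw [ZMod.val_one]; omega
      rw [ZMod.val_sub h1v, ZMod.val_one, ht, Nat.cast_sub (by omega)]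
      push_cast
      field_simp
      ring
  rcases hplus with hp | ⟨htop, hp0⟩
  · rcases hminus with hm | ⟨hbot, hm0⟩
    · rw [hp, hm]; exact key
    · -- bottom seam: `v = 0`, `(v − 1).val = |T| − 1`; shift the third argument by `+N`
      have e3 : (((v - 1).val : ℕ) : ℝ) / half P k M₀ - ((i : ℕ) : ℝ) = (t - 1 / (half P k M₀ : ℝ)) + nLab P j k M₀ := by
        have : (((v - 1).val : ℕ) : ℝ) = (P.sitesPerDir j : ℝ) - 1 := by
          have h := hm0
          have : ((((v - 1).val + 1 : ℕ)) : ℝ) = (P.sitesPerDir j : ℝ) := by exact_mod_cast h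
          push_cast at this; linarith
        rw [this, ← hSR, ht, hbot]; push_cast; field_simp; ring
      have ht0 : t = -((i : ℕ) : ℝ) := by rw [ht, hbot]; simp
      have h1h : 1 < half P k M₀ := by
        have := three_pow_le_half hC; have := Nat.one_le_pow k P.L P.L_pos; omega
      rw [hp, e3, per3_hprof_add_period hN]
      · exact key
      · rw [ht0]
        have : 1 / (half P k M₀ : ℝ) < 1 := by rw [div_lt_one hhR]; exact_mod_cast h1h
        linarith
      · rw [ht0]
        have : 0 < 1 / (half P k M₀ : ℝ) := by positivity
        linarith
  · rcases hminus with hm | ⟨hbot, _⟩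
    · -- top seam: `v = |T| − 1`, `(v + 1).val = 0`; shift the first argument by `+N`
      have e1 : (((v + 1).val : ℕ) : ℝ) / half P k M₀ - ((i : ℕ) : ℝ) + nLab P j k M₀ = t + 1 / (half P k M₀ : ℝ) := by
        have hv1 : ((v.val : ℕ) : ℝ) + 1 = (nLab P j k M₀ : ℝ) * half P k M₀ := by rw [hSR]; exact_mod_cast htop
        rw [hp0, ht]
        push_cast
        field_simp
        linarith
      have hlo : -(nLab P j k M₀ : ℝ) < (((v + 1).val : ℕ) : ℝ) / half P k M₀ - ((i : ℕ) : ℝ) := by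
        rw [hp0]; push_cast; rw [zero_div, zero_sub]; linarith
      have hhi : (((v + 1).val : ℕ) : ℝ) / half P k M₀ - ((i : ℕ) : ℝ) ≤ (nLab P j k M₀ : ℝ) - 1 := by
        rw [hp0]; push_cast; rw [zero_div, zero_sub]; linarith
      rw [← per3_hprof_add_period hN hlo hhi, e1, hm]
      exact key
    · -- both seams at once would force `|T| = 1`
      exfalso; omega

/-- kernel: the label of `x − e_μ` in direction `μ`. [folklore] -/
private theorem unshift_apply_self {j : ℕ} (x : Balaban1983to89.Site P j) (μ : Fin P.d) : (x.unshift μ) μ = x μ - 1 := by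
  show Function.update x μ (x μ - 1) μ = _
  rw [Function.update_self]

/-- kernel: the other labels of `x − e_μ`. [folklore] -/
private theorem unshift_apply_of_ne {j : ℕ} (x : Balaban1983to89.Site P j) {μ ν : Fin P.d} (h : ν ≠ μ) : (x.unshift μ) ν = x ν := by
  show Function.update x μ (x μ - 1) ν = _
  rw [Function.update_of_ne h]

/-- kernel: the label of `x + e_μ` in direction `μ`. [folklore] -/
private theorem shift_apply_self {j : ℕ} (x : Balaban1983to89.Site P j) (μ : Fin P.d) : (x.shift μ) μ = x μ + 1 := by
  show Function.update x μ (x μ + 1) μ = _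
  rw [Function.update_self]

/-- kernel: the other labels of `x + e_μ`. [folklore] -/
private theorem shift_apply_of_ne {j : ℕ} (x : Balaban1983to89.Site P j) {μ ν : Fin P.d} (h : ν ≠ μ) : (x.shift μ) ν = x ν := by
  show Function.update x μ (x μ + 1) ν = _
  rw [Function.update_of_ne h]

/-- **«|Δ^ηh_j| ≦ O(M^{−2})» ON THE TORUS**: `|h_i(x + e_μ) − 2h_i(x) + h_i(x − e_μ)| ≤ 3·sup|h″|/M²` at EVERY site `x` of `T^{(j)}`, every
direction (`M = L^kM₀`; the other `d − 1` factors of `h_i = Π_ν h_per(x_ν/M − i_ν)` are in `[0, 1]`). [cite: Balaban1983RegularityDecay, (2.10) p.576] -/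
theorem abs_hT_second_diff_le (hC : CubeSize P j k M₀) (i : Lab P j k M₀) (x : Balaban1983to89.Site P j) (μ : Fin P.d) :
    |hT k M₀ i (x.shift μ) - 2 * hT k M₀ i x + hT k M₀ i (x.unshift μ)| ≤ 3 * D2 hprof / (half P k M₀ : ℝ) ^ 2 := by
  have hN := hC.two_le
  unfold hT
  set g : Fin P.d → ZMod (P.sitesPerDir j) → ℝ := fun ν w =>
    per3 hprof (nLab P j k M₀) (((w.val : ℕ) : ℝ) / half P k M₀ - ((i ν : ℕ) : ℝ)) with hg
  have e0 : ∀ y : Balaban1983to89.Site P j, (∏ ν, per3 hprof (nLab P j k M₀) ((((y ν).val : ℕ) : ℝ) / half P k M₀ - ((i ν : ℕ) : ℝ)))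
      = g μ (y μ) * ∏ ν ∈ Finset.univ.erase μ, g ν (y ν) := fun y => (Finset.mul_prod_erase _ _ (Finset.mem_univ μ)).symm
  rw [e0, e0, e0]
  have e1 : ∏ ν ∈ Finset.univ.erase μ, g ν ((x.shift μ) ν) = ∏ ν ∈ Finset.univ.erase μ, g ν (x ν) :=
    Finset.prod_congr rfl fun ν hν => by rw [shift_apply_of_ne x (Finset.ne_of_mem_erase hν)]
  have e2 : ∏ ν ∈ Finset.univ.erase μ, g ν ((x.unshift μ) ν) = ∏ ν ∈ Finset.univ.erase μ, g ν (x ν) :=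
    Finset.prod_congr rfl fun ν hν => by rw [unshift_apply_of_ne x (Finset.ne_of_mem_erase hν)]
  rw [e1, e2, shift_apply_self, unshift_apply_self]
  set R := ∏ ν ∈ Finset.univ.erase μ, g ν (x ν)
  have hR : |R| ≤ 1 := by
    rw [Finset.abs_prod]
    exact Finset.prod_le_one (fun _ _ => abs_nonneg _) fun ν _ => by
      rw [hg, abs_of_nonneg (per3_hprof_mem_Icc hN _).1]; exact (per3_hprof_mem_Icc hN _).2
  have key := abs_per3_dir_second_diff_le hC (i μ) (x μ)
  calc |g μ (x μ + 1) * R - 2 * (g μ (x μ) * R) + g μ (x μ - 1) * R|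
      = |g μ (x μ + 1) - 2 * g μ (x μ) + g μ (x μ - 1)| * |R| := by rw [← abs_mul]; ring_nf
    _ ≤ 3 * D2 hprof / (half P k M₀ : ℝ) ^ 2 * 1 :=
        mul_le_mul key hR (abs_nonneg _) (by have := D2_nonneg contDiff_hprof hasCompactSupport_hprof; positivity)
    _ = _ := mul_one _

end SecondDiff

/-! ## §2 The window `□_i` as a translate of the no-wrap box `[0, 2M)^d` by a vector of the `k`-block lattice -/

section Window

variable {d : ℕ} (hPd : P.d = d + 1) {k M₀ : ℕ}

/-- The translation vector `v_i = Mi − M(1,…,1)` carrying the corner box `[0, 2M)^d` onto the window `□_i = [Mi − M, Mi + M)`.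
[cite: Balaban1983RegularityDecay, §2 p.575] -/
def shiftVec (k M₀ : ℕ) (i : Lab P 0 k M₀) : Balaban1983to89.Site P 0 :=
  fun μ => ((ctr k M₀ i μ - half P k M₀ : ℤ) : ZMod (P.sitesPerDir 0))

/-- `v_i ∈ L^kℤ^d` (`M = L^kM₀`). [cite: Balaban1983RegularityDecay, §2 p.575] -/
theorem isCoarse_shiftVec (hC : CubeSize P 0 k M₀) (i : Lab P 0 k M₀) : IsCoarse k (shiftVec k M₀ i) := by
  intro μ
  haveI : NeZero (P.sitesPerDir 0) := ⟨by have := P.one_lt_sitesPerDir 0; omega⟩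
  have hz : ((P.L ^ k : ℕ) : ℤ) ∣ (ctr k M₀ i μ - half P k M₀ : ℤ) := by
    unfold ctr half
    push_cast
    exact Dvd.intro (M₀ * ((i μ : ℕ) : ℤ) - M₀) (by ring)
  have hn : ((P.L ^ k : ℕ) : ℤ) ∣ (P.sitesPerDir 0 : ℤ) := Int.natCast_dvd_natCast.2 hC.pow_dvd
  have hv : (((shiftVec k M₀ i μ).val : ℕ) : ℤ) = (ctr k M₀ i μ - half P k M₀ : ℤ) % (P.sitesPerDir 0 : ℕ) := by
    unfold shiftVec; exact ZMod.val_intCast _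
  have h : ((P.L ^ k : ℕ) : ℤ) ∣ (((shiftVec k M₀ i μ).val : ℕ) : ℤ) := by
    rw [hv, Int.emod_def]
    exact dvd_sub hz (dvd_mul_of_dvd_left hn _)
  exact Int.natCast_dvd_natCast.1 h

/-- The corner box `□' = [0, 2M)^d` of the fine torus (the tree's no-wrap `cubeT` at the corner `0` with sides `L^k·2M₀`).
[cite: Balaban1983RegularityDecay, §2 p.575] -/
def box (k M₀ : ℕ) : Finset (Balaban1983to89.Site P 0) := cubeT hPd (P.L ^ k) (fun _ => 0) (fun _ => P.L ^ k * (2 * M₀))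

/-- kernel: the corner box fits (`2M ≤ |T|`). [cite: Balaban1983RegularityDecay, §2 p.575] -/
theorem box_fit (hC : CubeSize P 0 k M₀) : ∀ _i : Fin (d + 1), 0 * P.L ^ k + P.L ^ k * (2 * M₀) ≤ P.sitesPerDir 0 := fun _ => by
  have := hC.two_mul_half_le; unfold half at this; rw [zero_mul, zero_add]; linarith

/-- **Labels of the corner box**: `x ∈ □' ↔ x_μ < 2M` for all `μ`. [cite: Balaban1983RegularityDecay, §2 p.575] -/
theorem mem_box_iff (hC : CubeSize P 0 k M₀) (x : Balaban1983to89.Site P 0) : x ∈ box hPd k M₀ ↔ ∀ μ, (x μ).val < 2 * half P k M₀ := by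
  unfold box
  rw [mem_cubeT_iff_val hPd (box_fit hC)]
  unfold half
  simp only [zero_mul, zero_le, true_and, zero_add]
  constructor <;> intro h μ <;> have := h μ <;> linarith

/-- **`□_i = □' + v_i`**: the window of [6]'s partition is the translate of the corner box by `v_i ∈ L^kℤ^d`.
[cite: Balaban1983RegularityDecay, §2 p.575] -/
theorem image_box_eq_cube (hC : CubeSize P 0 k M₀) (i : Lab P 0 k M₀) :
    (box hPd k M₀).image (· + shiftVec k M₀ i) = cube k M₀ i := by
  haveI : NeZero (P.sitesPerDir 0) := ⟨by have := P.one_lt_sitesPerDir 0; omega⟩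
  have h2 := hC.two_mul_half_le
  ext x
  rw [Finset.mem_image, mem_cube]
  constructor
  · rintro ⟨y, hy, rfl⟩ μ
    have hyμ := (mem_box_iff hPd hC y).1 hy μ
    refine ⟨((y μ).val : ℤ) - half P k M₀, Finset.mem_Ico.2 ⟨by linarith, by omega⟩, ?_⟩
    rw [Balaban1983to89.Site.add_apply]
    unfold shiftVec
    conv_lhs => rw [← ZMod.natCast_zmod_val (y μ)]
    push_cast
    ring
  · intro hx
    refine ⟨x - shiftVec k M₀ i, ?_, sub_add_cancel _ _⟩
    rw [mem_box_iff hPd hC]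
    intro μ
    obtain ⟨z, hz, hxz⟩ := hx μ
    rw [Finset.mem_Ico] at hz
    obtain ⟨w, hw⟩ := Int.eq_ofNat_of_zero_le (show 0 ≤ z + half P k M₀ by omega)
    have hw2 : w < 2 * half P k M₀ := by omega
    have e : (x - shiftVec k M₀ i) μ = ((w : ℕ) : ZMod (P.sitesPerDir 0)) := by
      rw [show (x - shiftVec k M₀ i) μ = x μ - shiftVec k M₀ i μ from rfl, hxz]
      unfold shiftVec
      rw [show ((w : ℕ) : ZMod (P.sitesPerDir 0)) = ((w : ℤ) : ZMod (P.sitesPerDir 0)) by norm_cast, ← hw]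
      push_cast
      ring
    rw [e, ZMod.val_cast_of_lt (by omega)]
    exact hw2

end Window

/-! ## §3 Deep rows of the corner box: where the letter `K_i` lives, every `L^k`-ball stays inside `□'` -/

section Deep

variable {d : ℕ} (hPd : P.d = d + 1) {k M₀ : ℕ}

/-- `x` is `m`-DEEP in the corner box: `m ≤ x_μ` and `x_μ + m < 2M` for all `μ`. [cite: Balaban1983RegularityDecay, (2.19) p.578] -/
def Deep (k M₀ m : ℕ) (x : Balaban1983to89.Site P 0) : Prop := ∀ μ, m ≤ (x μ).val ∧ (x μ).val + m < 2 * half P k M₀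

/-- Deepness is monotone in the margin. [cite: Balaban1983RegularityDecay, (2.19) p.578] -/
theorem Deep.mono {m m' : ℕ} (h : m' ≤ m) {x : Balaban1983to89.Site P 0} (hx : Deep k M₀ m x) : Deep k M₀ m' x :=
  fun μ => ⟨h.trans (hx μ).1, by have := (hx μ).2; omega⟩

/-- **The support of the letter is deep**: if `x + v_i` lies within `R` of the centre `Mi` coordinatewise and `R + m < M`, then `x` is
`m`-deep in `□'`. [cite: Balaban1983RegularityDecay, (2.10) p.576] -/
theorem deep_of_near (hC : CubeSize P 0 k M₀) {R m : ℕ} (hRm : R + m < half P k M₀) {i : Lab P 0 k M₀} {x : Balaban1983to89.Site P 0}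
    (hx : Near k M₀ R i (x + shiftVec k M₀ i)) : Deep k M₀ m x := by
  haveI : NeZero (P.sitesPerDir 0) := ⟨by have := P.one_lt_sitesPerDir 0; omega⟩
  have h2 := hC.two_mul_half_le
  intro μ
  obtain ⟨z, hz, hxz⟩ := hx μ
  rw [Finset.mem_Icc] at hz
  obtain ⟨w, hw⟩ := Int.eq_ofNat_of_zero_le (show 0 ≤ z + half P k M₀ by omega)
  have e : x μ = ((w : ℕ) : ZMod (P.sitesPerDir 0)) := by
    have : x μ = (x + shiftVec k M₀ i) μ - shiftVec k M₀ i μ := by rw [Balaban1983to89.Site.add_apply, add_sub_cancel_right]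
    rw [this, hxz]
    unfold shiftVec
    rw [show ((w : ℕ) : ZMod (P.sitesPerDir 0)) = ((w : ℤ) : ZMod (P.sitesPerDir 0)) by norm_cast, ← hw]
    push_cast
    ring
  rw [e, ZMod.val_cast_of_lt (by omega)]
  constructor <;> omega

/-- Deep sites lie in the box. [cite: Balaban1983RegularityDecay, (2.19) p.578] -/
theorem mem_box_of_deep (hC : CubeSize P 0 k M₀) {m : ℕ} {x : Balaban1983to89.Site P 0} (hx : Deep k M₀ m x) : x ∈ box hPd k M₀ :=
  (mem_box_iff hPd hC x).2 fun μ => by have := (hx μ).2; omega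

/-- Neighbours of `(m+1)`-deep sites are `m`-deep (no wrap-around: `2M ≤ |T|`). [cite: Balaban1983RegularityDecay, (2.19) p.578] -/
theorem deep_shift (hC : CubeSize P 0 k M₀) {m : ℕ} {x : Balaban1983to89.Site P 0} (hx : Deep k M₀ (m + 1) x) (μ : Fin P.d) :
    Deep k M₀ m (x.shift μ) ∧ Deep k M₀ m (x.unshift μ) := by
  haveI : NeZero (P.sitesPerDir 0) := ⟨by have := P.one_lt_sitesPerDir 0; omega⟩
  have h2 := hC.two_mul_half_le
  have h1 : (1 : ZMod (P.sitesPerDir 0)).val = 1 := ZMod.val_one _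
  have hup : ((x.shift μ) μ).val = (x μ).val + 1 := by
    rw [shift_apply_self, ZMod.val_add_of_lt (by rw [h1]; have := (hx μ).2; omega), h1]
  have hdn : ((x.unshift μ) μ).val + 1 = (x μ).val := by
    rw [unshift_apply_self, ZMod.val_sub (by rw [h1]; have := (hx μ).1; omega), h1]
    have := (hx μ).1; omega
  constructor
  · intro ν
    by_cases hν : ν = μ
    · subst hν; rw [hup]; have := hx ν; omega
    · rw [shift_apply_of_ne x hν]; have := hx ν; omega
  · intro ν
    by_cases hν : ν = μ
    · subst hν; have := hx ν; omega
    · rw [unshift_apply_of_ne x hν]; have := hx ν; omega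

/-- All `2d` bonds at a `1`-deep site lie in the box. [cite: Balaban1983RegularityDecay, (2.6) p.576] -/
theorem bonds_mem_starB_of_deep (hC : CubeSize P 0 k M₀) {m : ℕ} {x : Balaban1983to89.Site P 0} (hx : Deep k M₀ (m + 1) x) (μ : Fin P.d) :
    (⟨x, μ⟩ : PBond P 0) ∈ starB (box hPd k M₀) ∧ (⟨x.unshift μ, μ⟩ : PBond P 0) ∈ starB (box hPd k M₀) := by
  have hx' := deep_shift hC hx μ
  refine ⟨(mem_starB _ _).2 ⟨mem_box_of_deep hPd hC hx, mem_box_of_deep hPd hC hx'.1⟩,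
    (mem_starB _ _).2 ⟨mem_box_of_deep hPd hC hx'.2, ?_⟩⟩
  rw [show (⟨x.unshift μ, μ⟩ : PBond P 0).tgt = x from (LatticeFieldCalculus.shiftEquiv (P := P) (j := 0) μ).apply_symm_apply x]
  exact mem_box_of_deep hPd hC hx

/-- kernel: a circular distance `< r` from a label `a` with `r ≤ a`, `a + r ≤ N`, is an honest distance `< r`. [folklore] -/
private theorem abs_sub_lt_of_circAbs_lt {N : ℕ} {r a b : ℤ} (hra : r ≤ a) (haN : a + r ≤ N) (haN' : a < N) (hb0 : 0 ≤ b) (hbN : b < N)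
    (h : B4TorusKernel.MultiPeriod.circAbs N (a - b) < r) : |a - b| < r := by
  unfold B4TorusKernel.MultiPeriod.circAbs at h
  have hmod0 := Int.emod_nonneg (a - b) (show (N : ℤ) ≠ 0 by omega)
  have hmodN := Int.emod_lt_of_pos (a - b) (show (0 : ℤ) < N by omega)
  by_cases hw : 0 ≤ a - b
  · have hmod : (a - b) % (N : ℤ) = a - b := Int.emod_eq_of_lt hw (by omega)
    rw [hmod] at h
    rcases min_lt_iff.1 h with h1 | h1
    · rw [abs_of_nonneg hw]; exact h1
    · omega
  · push Not at hw
    have hmod : (a - b) % (N : ℤ) = a - b + N := by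
      rw [← Int.add_emod_right]
      exact Int.emod_eq_of_lt (by omega) (by omega)
    rw [hmod] at h
    rcases min_lt_iff.1 h with h1 | h1
    · omega
    · rw [abs_of_neg hw]; linarith

/-- **Every `L^k`-ball around an `m`-deep site stays in the box** (`m ≥ L^k`): the deep-row hypothesis of the tree's derivative member
`decay110_smallField_cube_deriv_input`, in the sup torus distance `T`. [cite: Balaban1983RegularityDecay, (1.10) p.573] -/
theorem ball_subset_box_of_deep (hC : CubeSize P 0 k M₀) {m : ℕ} (hm : P.L ^ k ≤ m) {x : Balaban1983to89.Site P 0} (hx : Deep k M₀ m x)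
    (y : Balaban1983to89.Site P 0) (hy : B5Ineq137Torus.T P 0 x y < (P.L : ℝ) ^ k) : y ∈ box hPd k M₀ := by
  have h2 := hC.two_mul_half_le
  rw [mem_box_iff hPd hC]
  intro μ
  -- the coordinate circular distance is `< L^k`
  have hsup : (Finset.univ.sup (B4Sect5Torus.ccoord (B5Ineq137Torus.Nv P 0) (B5Ineq137Torus.toT x) (B5Ineq137Torus.toT y)) : ℕ) < P.L ^ k := by
    have h' : ((Finset.univ.sup (B4Sect5Torus.ccoord (B5Ineq137Torus.Nv P 0) (B5Ineq137Torus.toT x) (B5Ineq137Torus.toT y)) : ℕ) : ℝ)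
        < ((P.L ^ k : ℕ) : ℝ) := by
      have := hy; unfold B5Ineq137Torus.T B4Sect5Torus.tdist at this; push_cast at this ⊢; exact this
    exact_mod_cast h'
  have hμ : B4Sect5Torus.ccoord (B5Ineq137Torus.Nv P 0) (B5Ineq137Torus.toT x) (B5Ineq137Torus.toT y) μ < P.L ^ k :=
    (Finset.le_sup (Finset.mem_univ μ)).trans_lt hsup
  unfold B4Sect5Torus.ccoord at hμ
  have hN1 : 1 ≤ P.sitesPerDir 0 := (P.one_lt_sitesPerDir 0).le
  have hμ' : (B4TorusKernel.MultiPeriod.circAbs (P.sitesPerDir 0) ((((x μ).val : ℕ) : ℤ) - (((y μ).val : ℕ) : ℤ))).toNat < P.L ^ k := hμ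
  have hc0 := B4TorusKernel.MultiPeriod.circAbs_nonneg hN1 ((((x μ).val : ℕ) : ℤ) - (((y μ).val : ℕ) : ℤ))
  have hlt : B4TorusKernel.MultiPeriod.circAbs (P.sitesPerDir 0) ((((x μ).val : ℕ) : ℤ) - (((y μ).val : ℕ) : ℤ)) < (P.L ^ k : ℕ) := by
    have := Int.ofNat_lt.2 hμ'
    rw [Int.toNat_of_nonneg hc0] at this
    exact this
  have hxμ := hx μ
  have hyN : (y μ).val < P.sitesPerDir 0 := ZMod.val_lt _
  have key := abs_sub_lt_of_circAbs_lt (N := P.sitesPerDir 0) (r := (P.L ^ k : ℕ)) (a := ((x μ).val : ℕ)) (b := ((y μ).val : ℕ))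
    (by exact_mod_cast hm.trans hxμ.1) (by exact_mod_cast (show (x μ).val + P.L ^ k ≤ P.sitesPerDir 0 by omega))
    (by exact_mod_cast (show (x μ).val < P.sitesPerDir 0 by omega)) (by positivity) (by exact_mod_cast hyN) hlt
  rw [abs_lt] at key
  omega

end Deep

/-! ## §4 The letter at one row: the three terms of (2.10) against first/second differences of `h` and the size of `φ`, `D_uφ` -/

section ThreeTerms

variable {j : ℕ}

/-- **THE ROW ESTIMATE OF `K_i`** (the mechanism of *"R is a small operator … because |∂^ηh_j| ≦ O(M⁻¹), |Δ^ηh_j| ≦ O(M⁻²)"*): at a site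
`x` all of whose `2d` bonds lie in `Q_i`, for EVERY `U(1)` field, if the first differences of `h_i` at `x` are `≤ δ₁`, the second
differences `≤ δ₂`, the oscillation of `h_i` over the `k`-block of `x` is `≤ δ₃`, `|φ| ≤ Φ` everywhere and `|(D_uφ)(b)| ≤ Ψ` on the `2d` bonds at
`x`, then `|(K_iφ)(x)| ≤ |c|·2d·δ₁Ψ + c²·d·δ₂·Φ + |a|·L^{−kd}·δ₃·Φ` (file 2's three-term form (2.10) `kLet_mulVec`, `|u_b| = |u(Γ)| = 1`,
`#B^k(y) = L^{kd}`). [cite: Balaban1983RegularityDecay, (2.10) p.576] -/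
theorem norm_kLet_mulVec_le {J : Type*} (a c : ℝ) (U : GaugeField P j U1) {k : ℕ} (hk : j + k ≤ P.m + P.K)
    (Q : J → Finset (Balaban1983to89.Site P j)) (h : J → Balaban1983to89.Site P j → ℝ) (i : J) (φ : Balaban1983to89.Site P j → ℂ)
    (x : Balaban1983to89.Site P j) {δ₁ δ₂ δ₃ Φ Ψ : ℝ} (hδ₁ : 0 ≤ δ₁) (hδ₃ : 0 ≤ δ₃)
    (h1 : ∀ μ, |h i (x.shift μ) - h i x| ≤ δ₁ ∧ |h i (x.unshift μ) - h i x| ≤ δ₁)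
    (h2 : ∀ μ, |h i (x.shift μ) - 2 * h i x + h i (x.unshift μ)| ≤ δ₂)
    (hQ : ∀ μ, (⟨x, μ⟩ : PBond P j) ∈ starB (Q i) ∧ (⟨x.unshift μ, μ⟩ : PBond P j) ∈ starB (Q i))
    (h3 : ∀ x' ∈ blockK k (blkIter k x), |h i x' - h i x| ≤ δ₃)
    (hφ : ∀ y, ‖φ y‖ ≤ Φ)
    (hD : ∀ μ, ‖covD c (cfg U) φ ⟨x, μ⟩‖ ≤ Ψ ∧ ‖covD c (cfg U) φ ⟨x.unshift μ, μ⟩‖ ≤ Ψ) :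
    ‖(kLet a c U k Q h i *ᵥ φ) x‖
      ≤ |c| * (2 * P.d * (δ₁ * Ψ)) + c ^ 2 * (P.d * δ₂) * Φ + |a| * ((P.L : ℝ) ^ (k * P.d))⁻¹ * (δ₃ * Φ) := by
  rw [kLet_mulVec]
  -- the gradient term
  have hg : ‖gradTerm c U (Q i) (h i) φ x‖ ≤ |c| * (2 * P.d * (δ₁ * Ψ)) := by
    refine (norm_gradTerm_le c U (Q i) (h i) φ x).trans (mul_le_mul_of_nonneg_left ?_ (abs_nonneg c))
    calc ∑ μ : Fin P.d, (|h i (x.shift μ) - h i x| * ‖covD c (cfg U) φ ⟨x, μ⟩‖ + |h i (x.unshift μ) - h i x| * ‖covD c (cfg U) φ ⟨x.unshift μ, μ⟩‖)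
        ≤ ∑ _μ : Fin P.d, (δ₁ * Ψ + δ₁ * Ψ) := Finset.sum_le_sum fun μ _ =>
          add_le_add (mul_le_mul (h1 μ).1 (hD μ).1 (norm_nonneg _) hδ₁) (mul_le_mul (h1 μ).2 (hD μ).2 (norm_nonneg _) hδ₁)
      _ = 2 * P.d * (δ₁ * Ψ) := by rw [Finset.sum_const, Finset.card_univ, Fintype.card_fin, nsmul_eq_mul]; ring
  -- the Laplacian term
  have hl : ‖(lapNh c (Q i) (h i) x : ℂ) * φ x‖ ≤ c ^ 2 * (P.d * δ₂) * Φ := by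
    rw [norm_mul, Complex.norm_real, Real.norm_eq_abs, lapNh_eq_of_forall_mem (h i) hQ, abs_mul, abs_of_nonneg (sq_nonneg c)]
    refine mul_le_mul (mul_le_mul_of_nonneg_left ?_ (sq_nonneg c)) (hφ x) (norm_nonneg _) (by
      have : 0 ≤ δ₂ := (abs_nonneg _).trans (h2 ⟨0, P.hd⟩); positivity)
    calc |∑ μ : Fin P.d, (h i (x.shift μ) - 2 * h i x + h i (x.unshift μ))|
        ≤ ∑ μ : Fin P.d, |h i (x.shift μ) - 2 * h i x + h i (x.unshift μ)| := Finset.abs_sum_le_sum_abs _ _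
      _ ≤ ∑ _μ : Fin P.d, δ₂ := Finset.sum_le_sum fun μ _ => h2 μ
      _ = P.d * δ₂ := by rw [Finset.sum_const, Finset.card_univ, Fintype.card_fin, nsmul_eq_mul]
  -- the block term
  have hb : ‖blockTerm U (Q i) (h i) a k φ x‖ ≤ |a| * ((P.L : ℝ) ^ (k * P.d))⁻¹ * (δ₃ * Φ) := by
    refine (norm_blockTerm_le U (Q i) (h i) a k φ x).trans ?_
    have hL : (0 : ℝ) < (P.L : ℝ) ^ (k * P.d) := pow_pos P.cast_L_pos _
    have hcard : ((blockK k (blkIter k x)).card : ℝ) = (P.L : ℝ) ^ (k * P.d) := by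
      rw [card_blockK k hk]; push_cast; ring
    calc |a| * (((P.L : ℝ) ^ (k * P.d))⁻¹ * ((P.L : ℝ) ^ (k * P.d))⁻¹) * ∑ x' ∈ blockK k (blkIter k x), |h i x' - h i x| * ‖φ x'‖
        ≤ |a| * (((P.L : ℝ) ^ (k * P.d))⁻¹ * ((P.L : ℝ) ^ (k * P.d))⁻¹) * ∑ _x' ∈ blockK k (blkIter k x), δ₃ * Φ :=
          mul_le_mul_of_nonneg_left (Finset.sum_le_sum fun x' hx' => mul_le_mul (h3 x' hx') (hφ x') (norm_nonneg _) hδ₃) (by positivity)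
      _ = |a| * ((P.L : ℝ) ^ (k * P.d))⁻¹ * (δ₃ * Φ) := by
          rw [Finset.sum_const, nsmul_eq_mul, hcard]; field_simp
  set G := gradTerm c U (Q i) (h i) φ x
  set Lp := (lapNh c (Q i) (h i) x : ℂ) * φ x
  set B := blockTerm U (Q i) (h i) a k φ x
  have t1 : ‖G + Lp - B‖ ≤ ‖G + Lp‖ + ‖B‖ := norm_sub_le (G + Lp) B
  have t2 : ‖G + Lp‖ ≤ ‖G‖ + ‖Lp‖ := norm_add_le G Lp
  linarith

end ThreeTerms

/-! ## §5 The letter `K_iG_k(□_i,u)` moved to the corner box, its vanishing rows, and the bound `‖K_iG_k(□_i,u)‖_{∞→∞} ≤ C/M₀` -/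

section Letter

variable {d : ℕ} (hPd : P.d = d + 1) {k M₀ : ℕ}

open scoped Matrix.Norms.Operator

/-- kernel: a cut-off composed with a translation is the re-indexed multiplication operator. [cite: Balaban1983RegularityDecay, (2.2) p.575] -/
theorem mulR_comp_add {j : ℕ} (g : Balaban1983to89.Site P j → ℝ) (v : Balaban1983to89.Site P j) :
    mulR (fun x => g (x + v)) = (mulR g).submatrix (· + v) (· + v) := by
  ext x y
  unfold mulR
  simp only [submatrix_apply, diagonal_apply, add_left_inj]

/-- The families of the MOVED letter: every window replaced by the corner box `□'`, every cut-off by `h_l(· + v_i)`.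
[cite: Balaban1983RegularityDecay, (2.10) p.576] -/
def boxFam (k M₀ : ℕ) (_l : Lab P 0 k M₀) : Finset (Balaban1983to89.Site P 0) := box hPd k M₀

/-- The translated cut-offs `h_l(x + v_i)`. [cite: Balaban1983RegularityDecay, (2.10) p.576] -/
def hFam (k M₀ : ℕ) (i : Lab P 0 k M₀) (l : Lab P 0 k M₀) (x : Balaban1983to89.Site P 0) : ℝ := hT k M₀ l (x + shiftVec k M₀ i)

/-- **THE LETTER MOVED TO THE CORNER BOX**: `K_i(τ_{v_i}u; □′) = K_i(u; □_i)` re-indexed by `x ↦ x + v_i`.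
[cite: Balaban1983RegularityDecay, (2.10) p.576] -/
theorem kLet_translate (hC : CubeSize P 0 k M₀) (hk : 0 + k ≤ P.m + P.K) (a c : ℝ) (U : GaugeField P 0 U1) (i : Lab P 0 k M₀) :
    kLet a c (U.translate (shiftVec k M₀ i)) k (boxFam hPd k M₀) (hFam k M₀ i) i
      = (kLet a c U k (fun l => cube k M₀ l) (hT k M₀) i).submatrix (· + shiftVec k M₀ i) (· + shiftVec k M₀ i) := by
  set v := shiftVec k M₀ i
  unfold kLet boxFam
  rw [nOp_translate hk a c U _ (isCoarse_shiftVec hC i), image_box_eq_cube hPd hC i,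
    show mulR (hFam k M₀ i i) = (mulR (hT k M₀ i)).submatrix (· + v) (· + v) from mulR_comp_add _ _,
    ← submatrix_mul _ _ (· + v) (· + v) (· + v) (Equiv.addRight v).bijective,
    ← submatrix_mul _ _ (· + v) (· + v) (· + v) (Equiv.addRight v).bijective]
  rfl

/-- **`K_iG_k(□′, τ_{v_i}u) = K_iG_k(□_i, u)` re-indexed** — so the two have the same `ℓ^∞ → ℓ^∞` norm. [cite: Balaban1983RegularityDecay, (2.11) p.576] -/
theorem norm_letter_translate (hC : CubeSize P 0 k M₀) (hk : 0 + k ≤ P.m + P.K) (a c : ℝ) (U : GaugeField P 0 U1) (i : Lab P 0 k M₀) :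
    ‖kLet a c U k (fun l => cube k M₀ l) (hT k M₀) i * gBox a c U k (cube k M₀ i)‖
      = ‖kLet a c (U.translate (shiftVec k M₀ i)) k (boxFam hPd k M₀) (hFam k M₀ i) i
          * gBox a c (U.translate (shiftVec k M₀ i)) k (box hPd k M₀)‖ := by
  set v := shiftVec k M₀ i
  rw [kLet_translate hPd hC hk, gBox_translate hk a c U _ (isCoarse_shiftVec hC i), image_box_eq_cube hPd hC i,
    ← submatrix_mul _ _ (· + v) (· + v) (· + v) (Equiv.addRight v).bijective, norm_submatrix_add]

/-- **ROWS OFF THE ANNULUS VANISH**: if `x + v_i` is NOT within `⅝M + L^k` of the centre `Mi` coordinatewise, the row `x` of the moved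
letter `K_i` is zero (file 1's `kLet_apply_eq_zero_of_not_near_left`). [cite: Balaban1983RegularityDecay, (2.10) p.576] -/
theorem kLet_translate_mulVec_eq_zero (hC : CubeSize P 0 k M₀) (hk : 0 + k ≤ P.m + P.K) (a c : ℝ) (U : GaugeField P 0 U1) (i : Lab P 0 k M₀)
    {x : Balaban1983to89.Site P 0} (hx : ¬ Near k M₀ (5 * half P k M₀ / 8 + P.L ^ k) i (x + shiftVec k M₀ i))
    (φ : Balaban1983to89.Site P 0 → ℂ) :
    (kLet a c (U.translate (shiftVec k M₀ i)) k (boxFam hPd k M₀) (hFam k M₀ i) i *ᵥ φ) x = 0 := by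
  rw [kLet_translate hPd hC hk]
  simp only [mulVec, dotProduct, submatrix_apply]
  exact Finset.sum_eq_zero fun y _ => by
    rw [kLet_apply_eq_zero_of_not_near_left hC hk a c U (fun l => cube k M₀ l) i hx, zero_mul]

/-- kernel: `Site.tdist` is translation invariant. [folklore] -/
private theorem tdist_add_add {j : ℕ} (x y v : Balaban1983to89.Site P j) :
    Balaban1983to89.Site.tdist (x + v) (y + v) = Balaban1983to89.Site.tdist x y := by
  unfold Balaban1983to89.Site.tdist
  refine Finset.sum_congr rfl fun μ _ => ?_
  simp only [Balaban1983to89.Site.add_apply, add_sub_add_right_eq_sub]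

/-- kernel: `(y − e_μ) + e_μ = y`. [folklore] -/
private theorem shift_unshift' {j : ℕ} (y : Balaban1983to89.Site P j) (μ : Fin P.d) : (y.unshift μ).shift μ = y :=
  (LatticeFieldCalculus.shiftEquiv (P := P) (j := j) μ).apply_symm_apply y

/-- kernel: `(y + e_μ) − e_μ = y`. [folklore] -/
private theorem unshift_shift' {j : ℕ} (y : Balaban1983to89.Site P j) (μ : Fin P.d) : (y.shift μ).unshift μ = y :=
  (LatticeFieldCalculus.shiftEquiv (P := P) (j := j) μ).symm_apply_apply y

/-- kernel: `(x − e_μ) + v = (x + v) − e_μ`. [folklore] -/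
private theorem unshift_add {j : ℕ} (x v : Balaban1983to89.Site P j) (μ : Fin P.d) : x.unshift μ + v = (x + v).unshift μ := by
  have h1 : (x.unshift μ + v).shift μ = x + v := by rw [Balaban1983to89.Site.shift_add, shift_unshift']
  rw [← h1, unshift_shift']

/-- **THE FIRST AND SECOND DIFFERENCES AND THE BLOCK OSCILLATION OF THE MOVED CUT-OFF** `h_i(· + v_i)`: `≤ 3D₁/M`, `≤ 3D₂/M²`,
`≤ 3dD₁L^k/M` (torus-global bounds of files 1 and of §1, translation invariant). [cite: Balaban1983RegularityDecay, (2.10) p.576] -/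
theorem hFam_differences (hC : CubeSize P 0 k M₀) (hk : 0 + k ≤ P.m + P.K) (i : Lab P 0 k M₀) (x : Balaban1983to89.Site P 0) :
    (∀ μ, |hFam k M₀ i i (x.shift μ) - hFam k M₀ i i x| ≤ 3 * D1 hprof / half P k M₀
        ∧ |hFam k M₀ i i (x.unshift μ) - hFam k M₀ i i x| ≤ 3 * D1 hprof / half P k M₀)
    ∧ (∀ μ, |hFam k M₀ i i (x.shift μ) - 2 * hFam k M₀ i i x + hFam k M₀ i i (x.unshift μ)| ≤ 3 * D2 hprof / (half P k M₀ : ℝ) ^ 2)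
    ∧ (∀ x' ∈ blockK k (blkIter k x), |hFam k M₀ i i x' - hFam k M₀ i i x| ≤ 3 * D1 hprof * (P.d * P.L ^ k) / half P k M₀) := by
  set v := shiftVec k M₀ i
  have hh : (0 : ℝ) < half P k M₀ := by exact_mod_cast hC.pos_half
  have hD1 : 0 ≤ D1 hprof := D1_nonneg contDiff_hprof hasCompactSupport_hprof
  have one : ∀ y : Balaban1983to89.Site P 0, ∀ μ, |hT k M₀ i (y.shift μ) - hT k M₀ i y| ≤ 3 * D1 hprof / half P k M₀ := fun y μ => by
    refine (abs_hT_sub_le hC i _ _).trans ((div_le_div_iff_of_pos_right hh).2 (mul_le_of_le_one_right (by positivity) ?_))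
    rw [tdist_comm]; exact_mod_cast tdist_shift_le y μ
  unfold hFam
  refine ⟨fun μ => ⟨?_, ?_⟩, fun μ => ?_, fun x' hx' => ?_⟩
  · have h1 := one (x + v) μ
    rwa [Balaban1983to89.Site.shift_add] at h1
  · have h1 := one ((x + v).unshift μ) μ
    rwa [shift_unshift', abs_sub_comm, ← unshift_add] at h1
  · have h1 := abs_hT_second_diff_le hC i (x + v) μ
    rwa [Balaban1983to89.Site.shift_add, ← unshift_add] at h1
  · refine (abs_hT_sub_le hC i _ _).trans ((div_le_div_iff_of_pos_right hh).2 (mul_le_mul_of_nonneg_left ?_ (by positivity)))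
    rw [tdist_add_add]
    have hb : blkIter k x' = blkIter k x := mem_blockK.1 hx'
    have h1 := tdist_le_of_blkIter_eq hk hb
    have h2 : P.d * (P.L ^ k - 1) ≤ P.d * P.L ^ k := Nat.mul_le_mul_left _ (Nat.sub_le _ _)
    exact_mod_cast h1.trans h2

end Letter

/-! ## §6 THE LETTER BOUND `β = O(M₀⁻¹)` AT SMALL FIELDS, `k`-UNIFORM (p. 577 l. 1–2 + Lemma 2.1's role, via the tree's (1.10) members) -/

section Beta

open scoped Matrix.Norms.Operator

/-- **THE LETTERS OF (2.13) ARE SMALL: `‖K_iG_k(□_i, u)‖_{∞→∞} ≤ C/M₀`**, for every window `□_i` of [6]'s partition on the torus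
`T^{(0)}` (`M = L^kM₀`, `M₀ ≥ 16`, `N = |T|/M ≥ 3`), every `1 ≤ k ≤ K`, and every `U(1)` field that is SMALL on the torus in the sense of
the tree's (1.10) members (plaquettes `|u(∂p) − 1| ≤ θ` with `2d³(L^{2k}θ)² ≤ 1`, bond variables inside the `k`-blocks `|u_b − 1| ≤ T` and
block transports `|u(Γ^{(k)}_{x_k,x}) − 1| ≤ δ` with `2(L^k − 1)L^k·d·T² + 2δ² ≤ ½`), with a constant `C = C(d, L, a)` INDEPENDENT of
`k`, `M₀`, the torus and the field — the operator of record `H_k = (χD_u)ᴴ(χD_u) + α_kL^{kd}(Q_k)ᴴQ_k` with `c = ε⁻¹`, `α_k = a_k(L^kε)⁻²`.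
This is the quantitative content of *"R is a small operator in reasonable norms because |∂^ηh_j| ≦ O(M⁻¹), |Δ^ηh_j| ≦ O(M⁻²)"*
(p. 577 l. 1–2) on the torus: the three terms of (2.10) (file 2 `kLet_mulVec`) at the rows of the annulus `⅜M − L^k ≤ |x − Mi| ≤ ⅝M + L^k`
(file 1), fed with the tree's sup-norm members `|G_k(□,u)f| ≤ c₀(L^kε)²|f|_∞` (p27 `decay110_smallField_cube_input`) and
`|D_uG_k(□,u)f| ≤ c₁(L^kε)|f|_∞` at `L^k`-deep bonds (p34/p27 `decay110_smallField_cube_deriv_input`) after moving the window to the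
no-wrap corner box (§2, `BIJ88NeumannPropagatorTranslCovTorus`); rows off the annulus vanish.
[cite: Balaban1983RegularityDecay, (2.10)–(2.12) pp.576–577] -/
theorem norm_letter_le (d L : ℕ) (hd1 : 1 ≤ d) (hd3 : d + 1 ≤ 3) (hL : Odd L ∧ 1 < L) {a : ℝ} (ha : 0 < a) :
    ∃ C : ℝ, 0 < C ∧ ∀ (P : Params) (hPd : P.d = d + 1), P.L = L → ∀ k : ℕ, 1 ≤ k → k ≤ P.K →
      ∀ M₀ : ℕ, CubeSize P 0 k M₀ → 16 ≤ M₀ → 3 ≤ nLab P 0 k M₀ →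
      ∀ (U : GaugeField P 0 U1) (θ T δ : ℝ), 0 ≤ θ →
        (∀ p : Balaban1983to89.Plaq P 0, ‖toC (GaugeField.plaqHol U p) - 1‖ ≤ θ) →
        2 * (P.d : ℝ) ^ 3 * (((P.L : ℝ) ^ k) ^ 2 * θ) ^ 2 ≤ 1 →
        (∀ b : PBond P 0, blkIter k b.src = blkIter k b.tgt → ‖toC (U b) - 1‖ ≤ T) →
        (∀ y : Balaban1983to89.Site P 0, ‖holCK U k y - 1‖ ≤ δ) →
        2 * (((P.L : ℝ) ^ k - 1) * (P.L : ℝ) ^ k) * P.d * T ^ 2 + 2 * δ ^ 2 ≤ 1 / 2 →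
      ∀ i : Lab P 0 k M₀,
        ‖kLet (B1RG242Torus.α P a k * (P.L : ℝ) ^ (k * P.d)) P.eps⁻¹ U k (fun l => cube k M₀ l) (hT k M₀) i
            * gBox (B1RG242Torus.α P a k * (P.L : ℝ) ^ (k * P.d)) P.eps⁻¹ U k (cube k M₀ i)‖ ≤ C / M₀ := by
  obtain ⟨δ₀, c₀, hδ₀, hc₀, HV⟩ :=
    BIJ88NeumannPropagatorSmallFieldSupDecay.decay110_smallField_cube_input d (L - 1) hd3 (by obtain ⟨_, h1⟩ := hL; omega) ha
  obtain ⟨t₀, c₁, ht₀, hc₁, HD⟩ := BIJ88NeumannPropagatorSmallFieldCubeDeriv.decay110_smallField_cube_deriv_input d L hd1 hd3 hL ha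
  have hD1 : 0 ≤ D1 hprof := D1_nonneg contDiff_hprof hasCompactSupport_hprof
  have hD2 : 0 ≤ D2 hprof := D2_nonneg contDiff_hprof hasCompactSupport_hprof
  set Cst : ℝ := (d + 1 : ℝ) * (6 * D1 hprof * c₁ + 3 * D2 hprof * c₀ + 3 * D1 hprof * c₀ * a) + 1 with hCst
  refine ⟨Cst, by positivity, ?_⟩
  intro P hPd hPL k hk1 hkK M₀ hC hM hN3 U θ T δ hθ hplaq hsmθ hInt hTree hsmT i
  have hk : 0 + k ≤ P.m + P.K := by omega
  set a' : ℝ := B1RG242Torus.α P a k * (P.L : ℝ) ^ (k * P.d) with ha'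
  set v := shiftVec k M₀ i with hv
  -- positivity bookkeeping
  have hLr : (1 : ℝ) < P.L := by rw [hPL]; exact_mod_cast hL.2
  have hLk : (0 : ℝ) < (P.L : ℝ) ^ k := pow_pos P.cast_L_pos _
  have hLkd : (0 : ℝ) < (P.L : ℝ) ^ (k * P.d) := pow_pos P.cast_L_pos _
  have heps := P.eps_pos
  have hsp : P.spacing k = (P.L : ℝ) ^ k * P.eps := rfl
  have hM0 : (0 : ℝ) < M₀ := by exact_mod_cast (show 0 < M₀ by omega)
  have hhalf : (half P k M₀ : ℝ) = (P.L : ℝ) ^ k * M₀ := by unfold half; push_cast; ring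
  have hh : (0 : ℝ) < half P k M₀ := by exact_mod_cast hC.pos_half
  have haS : 0 < B1.aSeq a P.L k := B1.aSeq_pos ha hLr hk1
  have haSle : B1.aSeq a P.L k ≤ a := B1.aSeq_le ha hLr k hk1
  have ha'eq : a' = B1.aSeq a P.L k * (P.spacing k ^ 2)⁻¹ * (P.L : ℝ) ^ (k * P.d) := rfl
  have ha'pos : 0 < a' := by rw [ha'eq]; have := P.spacing_pos k; positivity
  have hd' : (P.d : ℝ) = d + 1 := by rw [hPd]; push_cast; ring
  -- move to the corner box
  rw [norm_letter_translate hPd hC hk]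
  set U' := U.translate v with hU'
  -- the hypotheses of the tree's members for `τ_vU` on the corner box
  have hM1 : ∀ _i : Fin (d + 1), 1 ≤ 2 * M₀ := fun _ => by omega
  have hfit := box_fit (d := d) hC
  have hNlt : ∀ _i : Fin (d + 1), P.L ^ k * (2 * M₀) < P.sitesPerDir 0 := fun _ => by
    have h1 := nLab_mul_half hC
    have h2 : 3 * half P k M₀ ≤ nLab P 0 k M₀ * half P k M₀ := Nat.mul_le_mul_right _ hN3
    have h3 := hC.pos_half
    have e : P.L ^ k * (2 * M₀) = 2 * half P k M₀ := by unfold half; ring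
    rw [e]; omega
  have hInt' : ∀ b ∈ starB (box hPd k M₀), blkIter k b.src = blkIter k b.tgt → ‖toC (U' b) - 1‖ ≤ T := fun b _ hb => by
    rw [hU', GaugeField.translate_apply]
    exact hInt _ ((blkIter_src_eq_tgt_iff hk (isCoarse_shiftVec hC i) b).2 hb)
  have hTree' : ∀ y ∈ box hPd k M₀, ‖holCK U' k y - 1‖ ≤ δ := fun y _ => by
    rw [hU', holCK_translate U k hk (isCoarse_shiftVec hC i)]; exact hTree _
  have hplaq' : ∀ p : Balaban1983to89.Plaq P 0, ‖toC (GaugeField.plaqHol U' p) - 1‖ ≤ θ := fun p => by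
    rw [hU', GaugeField.plaqHol_translate]; exact hplaq _
  -- the value member (every row) and the derivative member (deep rows), sources `f` with `|f| ≤ F`, `D = 0`
  have HVb : ∀ (f : Balaban1983to89.Site P 0 → ℂ) (F : ℝ), (∀ y, ‖f y‖ ≤ F) →
      ∀ x, ‖(gBox a' P.eps⁻¹ U' k (box hPd k M₀) *ᵥ f) x‖ ≤ P.spacing k ^ 2 * (c₀ * F) := by
    intro f F hF x
    have h := HV P hPd (by have := hL.2; omega) k hk1 (by omega) (fun _ => 0) (fun _ => 2 * M₀) hM1 hfit hNlt U' T δ hInt' hTree' hsmT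
      x f F 0 hF (fun y _ => B5Ineq137Torus.T_nonneg P 0 x y)
    simp only [mul_zero, neg_zero, Real.exp_zero, mul_one] at h
    exact h
  have HDb : ∀ x, (∀ y, B5Ineq137Torus.T P 0 x y < (P.L : ℝ) ^ k → y ∈ box hPd k M₀) →
      ∀ (f : Balaban1983to89.Site P 0 → ℂ) (F : ℝ), (∀ y, ‖f y‖ ≤ F) →
      ∀ μ, ‖covD P.eps⁻¹ (cfg U') (gBox a' P.eps⁻¹ U' k (box hPd k M₀) *ᵥ f) ⟨x, μ⟩‖ ≤ P.spacing k * (c₁ * F) := by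
    intro x hdeep f F hF μ
    have h := HD P hPd hPL k hk1 hkK (fun _ => 0) (fun _ => 2 * M₀) hM1 hfit hNlt U' θ T δ hθ hplaq' hsmθ hInt' hTree' hsmT
      x hdeep f F 0 hF (fun y _ => B5Ineq137Torus.T_nonneg P 0 x y) μ
    simp only [mul_zero, neg_zero, Real.exp_zero, mul_one] at h
    exact h
  -- the row bound
  have hsp0 := P.spacing_pos k
  obtain ⟨β₀, hβ₀⟩ : ∃ β₀ : ℝ, β₀ = |P.eps⁻¹| * (2 * P.d * ((3 * D1 hprof / half P k M₀) * (P.spacing k * (c₁ * 1))))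
      + P.eps⁻¹ ^ 2 * (P.d * (3 * D2 hprof / (half P k M₀ : ℝ) ^ 2)) * (P.spacing k ^ 2 * (c₀ * 1))
      + |a'| * ((P.L : ℝ) ^ (k * P.d))⁻¹ * ((3 * D1 hprof * (P.d * P.L ^ k) / half P k M₀) * (P.spacing k ^ 2 * (c₀ * 1))) := ⟨_, rfl⟩
  have hβ0 : 0 ≤ β₀ := by rw [hβ₀]; positivity
  have key : ∀ (f : Balaban1983to89.Site P 0 → ℂ), (∀ y, ‖f y‖ ≤ 1) → ∀ x,
      ‖((kLet a' P.eps⁻¹ U' k (boxFam hPd k M₀) (hFam k M₀ i) i * gBox a' P.eps⁻¹ U' k (box hPd k M₀)) *ᵥ f) x‖ ≤ β₀ := by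
    intro f hf x
    rw [← mulVec_mulVec]
    by_cases hx : Near k M₀ (5 * half P k M₀ / 8 + P.L ^ k) i (x + v)
    · -- a row of the annulus (or of the core): deep in the corner box
      have hdeep : Deep k M₀ (P.L ^ k + 1) x := by
        refine deep_of_near hC ?_ hx
        have hn1 : 1 ≤ P.L ^ k := Nat.one_le_pow _ _ P.L_pos
        have h16 : 16 * P.L ^ k ≤ half P k M₀ := by
          calc 16 * P.L ^ k ≤ M₀ * P.L ^ k := Nat.mul_le_mul_right _ hM
            _ = half P k M₀ := by unfold half; ring
        omega
      obtain ⟨h1, h2, h3⟩ := hFam_differences hC hk i x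
      have hQ := fun μ => bonds_mem_starB_of_deep hPd hC hdeep μ
      have hDx : ∀ μ, ‖covD P.eps⁻¹ (cfg U') (gBox a' P.eps⁻¹ U' k (box hPd k M₀) *ᵥ f) ⟨x, μ⟩‖ ≤ P.spacing k * (c₁ * 1)
          ∧ ‖covD P.eps⁻¹ (cfg U') (gBox a' P.eps⁻¹ U' k (box hPd k M₀) *ᵥ f) ⟨x.unshift μ, μ⟩‖ ≤ P.spacing k * (c₁ * 1) := fun μ =>
        ⟨HDb x (ball_subset_box_of_deep hPd hC (m := P.L ^ k + 1) (by omega) hdeep) f 1 hf μ,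
          HDb (x.unshift μ) (ball_subset_box_of_deep hPd hC (m := P.L ^ k) le_rfl (deep_shift hC hdeep μ).2) f 1 hf μ⟩
      have hres := norm_kLet_mulVec_le a' P.eps⁻¹ U' hk (boxFam hPd k M₀) (hFam k M₀ i) i
        (gBox a' P.eps⁻¹ U' k (box hPd k M₀) *ᵥ f) x (by positivity) (by positivity) h1 h2 hQ h3 (HVb f 1 hf) hDx
      rw [hβ₀]
      exact hres
    · rw [kLet_translate_mulVec_eq_zero hPd hC hk a' P.eps⁻¹ U i hx, norm_zero]
      exact hβ0
  refine (linfty_opNorm_le_of_mulVec_le hβ0 key).trans ?_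
  -- arithmetic: `β₀ ≤ C/M₀`
  have heinv : |P.eps⁻¹| = P.eps⁻¹ := abs_of_pos (inv_pos.2 heps)
  have ha'abs : |a'| = a' := abs_of_pos ha'pos
  have t1 : |P.eps⁻¹| * (2 * P.d * ((3 * D1 hprof / half P k M₀) * (P.spacing k * (c₁ * 1))))
      = (P.d : ℝ) * (6 * D1 hprof * c₁) / M₀ := by
    rw [heinv, hsp, hhalf]; field_simp; ring
  have t2 : P.eps⁻¹ ^ 2 * (P.d * (3 * D2 hprof / (half P k M₀ : ℝ) ^ 2)) * (P.spacing k ^ 2 * (c₀ * 1))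
      = (P.d : ℝ) * (3 * D2 hprof * c₀) / M₀ / M₀ := by
    rw [hsp, hhalf]; field_simp
  have t3 : |a'| * ((P.L : ℝ) ^ (k * P.d))⁻¹ * ((3 * D1 hprof * (P.d * P.L ^ k) / half P k M₀) * (P.spacing k ^ 2 * (c₀ * 1)))
      = (P.d : ℝ) * (3 * D1 hprof * c₀ * B1.aSeq a P.L k) / M₀ := by
    rw [ha'abs, ha'eq, hsp, hhalf]; field_simp
  have t2' : (P.d : ℝ) * (3 * D2 hprof * c₀) / M₀ / M₀ ≤ (P.d : ℝ) * (3 * D2 hprof * c₀) / M₀ :=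
    div_le_self (by positivity) (by exact_mod_cast (show 1 ≤ M₀ by omega))
  have t3' : (P.d : ℝ) * (3 * D1 hprof * c₀ * B1.aSeq a P.L k) / M₀ ≤ (P.d : ℝ) * (3 * D1 hprof * c₀ * a) / M₀ :=
    div_le_div_of_nonneg_right (mul_le_mul_of_nonneg_left (mul_le_mul_of_nonneg_left haSle (by positivity)) (by positivity)) hM0.le
  have hsum : β₀ ≤ ((P.d : ℝ) * (6 * D1 hprof * c₁) + (P.d : ℝ) * (3 * D2 hprof * c₀) + (P.d : ℝ) * (3 * D1 hprof * c₀ * a)) / M₀ := by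
    rw [hβ₀, t1, t2, t3, add_div, add_div]
    exact add_le_add (add_le_add le_rfl t2') t3'
  refine hsum.trans (div_le_div_of_nonneg_right ?_ hM0.le)
  have e : Cst - ((P.d : ℝ) * (6 * D1 hprof * c₁) + (P.d : ℝ) * (3 * D2 hprof * c₀) + (P.d : ℝ) * (3 * D1 hprof * c₀ * a)) = 1 := by
    rw [hCst, hd']; ring
  linarith

/-- **THE FIRST LETTER IS BOUNDED: `‖G_k(□_i, u)‖_{∞→∞} ≤ c₀(L^kε)²`** for every window of [6]'s partition on the torus and every
`U(1)` field small in the sense of the tree's value member (in-block bond variables and block transports) — the role of Lemma 2.1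
(*"the L₂-norm of the operator R … is small for M large enough"* needs `‖G_k(□_j,A_j)‖` bounded, (2.15)) in the sup norm of record:
p27's `decay110_smallField_cube_input` at every row of the corner box, moved to `□_i` by `BIJ88NeumannPropagatorTranslCovTorus`.
[cite: Balaban1983RegularityDecay, (2.15) p.577] -/
theorem norm_gBox_cube_le (d L : ℕ) (hd3 : d + 1 ≤ 3) (hL : 1 < L) {a : ℝ} (ha : 0 < a) :
    ∃ c₀ : ℝ, 0 < c₀ ∧ ∀ (P : Params) (hPd : P.d = d + 1), P.L = L → ∀ k : ℕ, 1 ≤ k → k ≤ P.m + P.K →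
      ∀ M₀ : ℕ, CubeSize P 0 k M₀ → 3 ≤ nLab P 0 k M₀ →
      ∀ (U : GaugeField P 0 U1) (T δ : ℝ),
        (∀ b : PBond P 0, blkIter k b.src = blkIter k b.tgt → ‖toC (U b) - 1‖ ≤ T) →
        (∀ y : Balaban1983to89.Site P 0, ‖holCK U k y - 1‖ ≤ δ) →
        2 * (((P.L : ℝ) ^ k - 1) * (P.L : ℝ) ^ k) * P.d * T ^ 2 + 2 * δ ^ 2 ≤ 1 / 2 →
      ∀ i : Lab P 0 k M₀, ‖gBox (B1RG242Torus.α P a k * (P.L : ℝ) ^ (k * P.d)) P.eps⁻¹ U k (cube k M₀ i)‖ ≤ c₀ * P.spacing k ^ 2 := by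
  obtain ⟨δ₀, c₀, hδ₀, hc₀, HV⟩ :=
    BIJ88NeumannPropagatorSmallFieldSupDecay.decay110_smallField_cube_input d (L - 1) hd3 (by omega) ha
  refine ⟨c₀, hc₀, ?_⟩
  intro P hPd hPL k hk1 hk M₀ hC hN3 U T δ hInt hTree hsmT i
  have hk' : 0 + k ≤ P.m + P.K := by omega
  set v := shiftVec k M₀ i with hv
  rw [← image_box_eq_cube hPd hC i, ← norm_gBox_translate hk' _ _ U _ (isCoarse_shiftVec hC i)]
  set U' := U.translate v with hU'
  have hM1 : ∀ _i : Fin (d + 1), 1 ≤ 2 * M₀ := fun _ => by have := hC.three_le; omega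
  have hfit := box_fit (d := d) hC
  have hNlt : ∀ _i : Fin (d + 1), P.L ^ k * (2 * M₀) < P.sitesPerDir 0 := fun _ => by
    have h1 := nLab_mul_half hC
    have h2 : 3 * half P k M₀ ≤ nLab P 0 k M₀ * half P k M₀ := Nat.mul_le_mul_right _ hN3
    have h3 := hC.pos_half
    have e : P.L ^ k * (2 * M₀) = 2 * half P k M₀ := by unfold half; ring
    rw [e]; omega
  have hInt' : ∀ b ∈ starB (box hPd k M₀), blkIter k b.src = blkIter k b.tgt → ‖toC (U' b) - 1‖ ≤ T := fun b _ hb => by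
    rw [hU', GaugeField.translate_apply]
    exact hInt _ ((blkIter_src_eq_tgt_iff hk' (isCoarse_shiftVec hC i) b).2 hb)
  have hTree' : ∀ y ∈ box hPd k M₀, ‖holCK U' k y - 1‖ ≤ δ := fun y _ => by
    rw [hU', holCK_translate U k hk' (isCoarse_shiftVec hC i)]; exact hTree _
  refine linfty_opNorm_le_of_mulVec_le (by have := P.spacing_pos k; positivity) fun f hf x => ?_
  have h := HV P hPd (by omega) k hk1 hk (fun _ => 0) (fun _ => 2 * M₀) hM1 hfit hNlt U' T δ hInt' hTree' hsmT
    x f 1 0 hf (fun y _ => B5Ineq137Torus.T_nonneg P 0 x y)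
  simp only [mul_zero, neg_zero, Real.exp_zero, mul_one] at h
  unfold box
  linarith

end Beta

/-! ## §7 THE RANDOM WALK EXPANSION (2.13) OF `G_k(u)` ON THE WHOLE TORUS CONVERGES AT SMALL FIELDS, `M₀ ≥ M₁(d, L, a)` -/

section Torus

open scoped Matrix.Norms.Operator

/-- **(2.12)/(2.13) FOR `G_k(u) = G_k(T^{(0)}, u)` WITH [6]'S OWN CUBES, HYPOTHESIS-FREE AT SMALL FIELDS**: there is `M₁ = M₁(d, L, a)`
such that for every torus of the series, every `1 ≤ k ≤ K`, every cube size `M = L^kM₀` with `M₀ ≥ M₁` (`M ∣ |T|`, `|T|/M ≥ 3`) and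
every `U(1)` field small in the sense of the tree's (1.10) members (plaquettes, in-block bond variables, block transports), the random
walk expansion `G_k(u) = Σ_ω h_{ω₀}G_k(□_{ω₀},u)h_{ω₀}K_{ω₁}G_k(□_{ω₁},u)h_{ω₁}⋯K_{ω_n}G_k(□_{ω_n},u)h_{ω_n}` converges (unconditionally, as
a `HasSum` over all walks) to the whole-torus propagator — file 1's `hasSum_piece_cubes` (gen 25's (2.13) with the localization datum, the
multiplicity `2^d`, the adjacency degree `3^d` and the «obvious fact» discharged) with its LAST input, the letter bound `β`, discharged by
`norm_letter_le`: `β = C/M₀`, `3^dβ < 1` for `M₀ > 3^dC` (*"M fixed with 3^dc₂O(1)M^{−1} ≤ e^{−1}"*, (2.22) p. 579).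
[cite: Balaban1983RegularityDecay, (2.13) p.577] -/
theorem hasSum_piece_torus (d L : ℕ) (hd1 : 1 ≤ d) (hd3 : d + 1 ≤ 3) (hL : Odd L ∧ 1 < L) {a : ℝ} (ha : 0 < a) :
    ∃ M₁ : ℕ, ∀ (P : Params) (_hPd : P.d = d + 1), P.L = L → ∀ k : ℕ, 1 ≤ k → k ≤ P.K →
      ∀ M₀ : ℕ, CubeSize P 0 k M₀ → M₁ ≤ M₀ → 3 ≤ nLab P 0 k M₀ →
      ∀ (U : GaugeField P 0 U1) (θ T δ : ℝ), 0 ≤ θ →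
        (∀ p : Balaban1983to89.Plaq P 0, ‖toC (GaugeField.plaqHol U p) - 1‖ ≤ θ) →
        2 * (P.d : ℝ) ^ 3 * (((P.L : ℝ) ^ k) ^ 2 * θ) ^ 2 ≤ 1 →
        (∀ b : PBond P 0, blkIter k b.src = blkIter k b.tgt → ‖toC (U b) - 1‖ ≤ T) →
        (∀ y : Balaban1983to89.Site P 0, ‖holCK U k y - 1‖ ≤ δ) →
        2 * (((P.L : ℝ) ^ k - 1) * (P.L : ℝ) ^ k) * P.d * T ^ 2 + 2 * δ ^ 2 ≤ 1 / 2 →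
      HasSum (piece (B1RG242Torus.α P a k * (P.L : ℝ) ^ (k * P.d)) P.eps⁻¹ U k (fun i : Lab P 0 k M₀ => cube k M₀ i) (hT k M₀))
        (gBox (B1RG242Torus.α P a k * (P.L : ℝ) ^ (k * P.d)) P.eps⁻¹ U k univ) := by
  obtain ⟨C, hC0, H⟩ := norm_letter_le d L hd1 hd3 hL ha
  refine ⟨max 16 (⌈(3 : ℝ) ^ (d + 1) * C⌉₊ + 1), ?_⟩
  intro P hPd hPL k hk1 hkK M₀ hC hM hN3 U θ T δ hθ hplaq hsmθ hInt hTree hsmT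
  have hM16 : 16 ≤ M₀ := le_trans (le_max_left _ _) hM
  have hMC : ⌈(3 : ℝ) ^ (d + 1) * C⌉₊ + 1 ≤ M₀ := le_trans (le_max_right _ _) hM
  have hk : 0 + k ≤ P.m + P.K := by omega
  have hLr : (1 : ℝ) < P.L := by rw [hPL]; exact_mod_cast hL.2
  have hc : P.eps⁻¹ ≠ 0 := inv_ne_zero P.eps_pos.ne'
  have ha' : 0 < B1RG242Torus.α P a k * (P.L : ℝ) ^ (k * P.d) := by
    have := B1.aSeq_pos ha hLr hk1; have := P.spacing_pos k; have := P.cast_L_pos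
    unfold B1RG242Torus.α; positivity
  have hM0 : (0 : ℝ) < M₀ := by exact_mod_cast (show 0 < M₀ by omega)
  have hβ := H P hPd hPL k hk1 hkK M₀ hC hM16 hN3 U θ T δ hθ hplaq hsmθ hInt hTree hsmT
  -- `3^dβ < 1` and `2^dβ < 1` for `β = C/M₀`
  have h3C : (3 : ℝ) ^ (d + 1) * C < M₀ := by
    have h1 := Nat.le_ceil ((3 : ℝ) ^ (d + 1) * C)
    have h2 : ((⌈(3 : ℝ) ^ (d + 1) * C⌉₊ : ℕ) : ℝ) + 1 ≤ M₀ := by exact_mod_cast hMC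
    linarith
  have hDβ : ((3 ^ P.d : ℕ) : ℝ) * (C / M₀) < 1 := by
    rw [hPd, ← mul_div_assoc, div_lt_one hM0]; push_cast; exact h3C
  have hmβ : ((2 ^ P.d : ℕ) : ℝ) * (C / M₀) < 1 := by
    refine lt_of_le_of_lt (mul_le_mul_of_nonneg_right ?_ (by positivity)) hDβ
    exact_mod_cast Nat.pow_le_pow_left (by norm_num) P.d
  have h := hasSum_piece_cubes hC hk hc ha' U (isBlockUnion_univ k)
    (α := ∑ i : Lab P 0 k M₀, ‖gBox (B1RG242Torus.α P a k * (P.L : ℝ) ^ (k * P.d)) P.eps⁻¹ U k (cube k M₀ i)‖) (β := C / M₀)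
    (fun i => by
      rw [Finset.univ_inter]
      exact Finset.single_le_sum (f := fun l => ‖gBox (B1RG242Torus.α P a k * (P.L : ℝ) ^ (k * P.d)) P.eps⁻¹ U k (cube k M₀ l)‖)
        (fun _ _ => norm_nonneg _) (Finset.mem_univ i))
    (by positivity) (fun i => by simp only [Finset.univ_inter]; exact hβ i) hDβ hmβ
  simp only [Finset.univ_inter] at h
  exact h

end Torus

end

end Literature.MathematicalPhysics.QuantumFieldTheory.BalabanImbrieJaffe1984to88.BIJ88NeumannRandomWalkSmallFieldTorus
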